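import Mathlib.MeasureTheory.Group.Integral
import Literature.Analysis.FluidPDE.DissipatesAtScale
import Literature.Analysis.FluidPDE.RapidDecayLemmas
import Literature.Analysis.FluidPDE.ClassicalSolutionGalilean
import HarnessLib

/-!
# Crux `SelfMixingDichotomy.CoherentScaleExclusion` (stmt-NavierStokesRegularity-1423), line
  `registered`: stub INV1 `stub_dissipatesAtScale_translate` — translation invariance of the
  scalar dissipation factor `DissipatesAtScale`

Support file (`--supports stmt-NavierStokesRegularity-1423`) of the line lead c3. The route's MIX
functional `DissipatesAtScale u T x₀ r δ` (every admissible scalar `θ` — jointly smooth with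
uniform rapid decay on the slab `S × ℝ³`, `S = [T − r², T − r²/2]`, solving
`∂ₜθ + ⟪u, ∇θ⟫ = Δθ` there with datum `θ(T − r²)` supported in `B_r(x₀)` — keeps at most the
fraction `δ` of its `L²` norm: `∫ θ(T − r²/2)² ≤ δ² ∫ θ(T − r²)²`) is invariant under spatial
translations: `DissipatesAtScale u T x₀ r δ ↔ DissipatesAtScale (u(t, · + x₀)) T 0 r δ`.

Proof. One transfer lemma `mixTranslate_dissipatesAtScale_comp_add`: if `u` dissipates at
`(T, x₁ + c)` then the translated drift `(t, y) ↦ u t (y + c)` dissipates at `(T, x₁)`. Given a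
scalar `θ'` admissible for the translated drift at centre `x₁`, the pulled-back scalar
`θ t x = θ' t (x − c)` is admissible for `u` at centre `x₁ + c`:
* joint smoothness: `IsSmoothSpaceTimeOn.comp_add_curve` (constant path);
* uniform rapid decay (`mixTranslate_hasUniformRapidDecayOn_comp_add`): the within-slab
  derivatives of the translate are the translates of the derivatives
  (`iteratedFDerivWithin_comp_add_right`, the slab `S × ℝ³` being invariant under `(0, a) +ᵥ ·`),
  and the weight moves by `1 + ‖y‖ ≤ (1 + ‖a‖)(1 + ‖y + a‖)`;
* the equation: `timeDerivWithin` is pointwise in `x` (`rfl`), `∇(θ(· + a))(y) = ∇θ(y + a)`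
  (`fderiv_comp_add_right`), `Δ(θ(· + a))(y) = Δθ(y + a)` (`laplacian_comp_add_right`);
* the support of the datum moves by `c` (`dist_add_right`);
and the two whole-space integrals are translation invariant (`integral_add_right_eq_self`).
Both directions of the stub are instances of the transfer lemma (`c = x₀`, resp. `c = −x₀`
applied to the translated drift).
-/

noncomputable section

open MeasureTheory Set Function Metric
open scoped ContDiff Laplacian Pointwise

-- `Summit = Problem` for this summit; the tree lakefile sets `weak.linter.dupNamespace = false`.
set_option linter.dupNamespace false

namespace Summit.NavierStokesRegularity.NavierStokesRegularity.Theorems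

open Literature.Analysis.FluidPDE

/-- **Uniform rapid decay is preserved by a constant translation of space.** If `w` has uniform
rapid decay of all within-slab space–time derivatives on `S × X`, so does `(t, y) ↦ w t (y + a)`:
the within-slab iterated derivatives of the translate at `(t, y)` are those of `w` at
`(t, y + a)` (`iteratedFDerivWithin_comp_add_right`; the slab `S × X` is invariant under the
translation by `(0, a)`), and `(1 + ‖y‖)^K ≤ (1 + ‖a‖)^K (1 + ‖y + a‖)^K`, so the constant
`C_{n,K}` becomes `(1 + ‖a‖)^K C_{n,K}`. -/
theorem mixTranslate_hasUniformRapidDecayOn_comp_add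
    {X : Type*} [NormedAddCommGroup X] [NormedSpace ℝ X]
    {F : Type*} [NormedAddCommGroup F] [NormedSpace ℝ F]
    {S : Set ℝ} {w : ℝ → X → F} (hd : HasUniformRapidDecayOn S w) (a : X) :
    HasUniformRapidDecayOn S (fun t y => w t (y + a)) := by
  intro n K
  obtain ⟨C, hC⟩ := hd n K
  refine ⟨(1 + ‖a‖) ^ K * C, fun t ht y => ?_⟩
  have hfun : uncurry (fun t y => w t (y + a)) =
      fun z : ℝ × X => uncurry w (z + (((0 : ℝ), a) : ℝ × X)) := by
    funext z
    obtain ⟨s, x⟩ := z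
    simp
  have hvadd : (((0 : ℝ), a) : ℝ × X) +ᵥ (S ×ˢ (univ : Set X)) = S ×ˢ univ := by
    ext ⟨s, x⟩
    rw [mem_vadd_set_iff_neg_vadd_mem, vadd_eq_add]
    simp
  have hkey : iteratedFDerivWithin ℝ n (uncurry (fun t y => w t (y + a))) (S ×ˢ univ) (t, y) =
      iteratedFDerivWithin ℝ n (uncurry w) (S ×ˢ univ) (t, y + a) := by
    rw [hfun, iteratedFDerivWithin_comp_add_right n (((0 : ℝ), a) : ℝ × X) (t, y), hvadd,
      Prod.mk_add_mk, add_zero]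
  have hya : ‖y‖ ≤ ‖y + a‖ + ‖a‖ := by
    calc ‖y‖ = ‖(y + a) - a‖ := by rw [add_sub_cancel_right]
      _ ≤ ‖y + a‖ + ‖a‖ := norm_sub_le _ _
  have hw : (1 + ‖y‖) ^ K ≤ (1 + ‖a‖) ^ K * (1 + ‖y + a‖) ^ K := by
    rw [← mul_pow]
    apply pow_le_pow_left₀ (by positivity)
    nlinarith [norm_nonneg a, norm_nonneg (y + a), mul_nonneg (norm_nonneg a) (norm_nonneg (y + a))]
  calc (1 + ‖y‖) ^ K * ‖iteratedFDerivWithin ℝ n (uncurry (fun t y => w t (y + a))) (S ×ˢ univ) (t, y)‖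
      ≤ ((1 + ‖a‖) ^ K * (1 + ‖y + a‖) ^ K) *
          ‖iteratedFDerivWithin ℝ n (uncurry w) (S ×ˢ univ) (t, y + a)‖ := by
        rw [hkey]
        exact mul_le_mul_of_nonneg_right hw (norm_nonneg _)
    _ = (1 + ‖a‖) ^ K *
          ((1 + ‖y + a‖) ^ K * ‖iteratedFDerivWithin ℝ n (uncurry w) (S ×ˢ univ) (t, y + a)‖) := by
        ring
    _ ≤ (1 + ‖a‖) ^ K * C := mul_le_mul_of_nonneg_left (hC t ht (y + a)) (by positivity)

/-- The one-sided time derivative within `S` commutes with a constant translation of space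
(it is taken pointwise in the space variable; definitional). -/
theorem mixTranslate_timeDerivWithin_comp_add
    {X : Type*} {F : Type*} [NormedAddCommGroup F] [NormedSpace ℝ F] [Add X]
    (S : Set ℝ) (w : ℝ → X → F) (a : X) (t : ℝ) (y : X) :
    timeDerivWithin S (fun s z => w s (z + a)) t y = timeDerivWithin S w t (y + a) :=
  rfl

/-- The gradient commutes with translations: `∇(θ(· + a))(y) = (∇θ)(y + a)`
(Mathlib `fderiv_comp_add_right`, no differentiability needed). -/
theorem mixTranslate_gradient_comp_add
    {E : Type*} [NormedAddCommGroup E] [InnerProductSpace ℝ E] [CompleteSpace E]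
    (θ : E → ℝ) (a y : E) :
    gradient (fun z => θ (z + a)) y = gradient θ (y + a) := by
  unfold gradient
  rw [fderiv_comp_add_right]

/-- **Transfer of the dissipation factor to a translated frame.** If the drift `u` dissipates at
scale `r` with factor `δ` at `(T, x₁ + c)`, then the translated drift `(t, y) ↦ u t (y + c)`
dissipates at scale `r` with factor `δ` at `(T, x₁)`: a scalar `θ'` admissible for the translated
drift at centre `x₁` pulls back to the scalar `θ t x = θ' t (x − c)` admissible for `u` at centre
`x₁ + c` (smoothness, uniform rapid decay, the advection–diffusion equation and the support of the
datum are all translation covariant), with the same two whole-space `L²` integrals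
(`integral_add_right_eq_self`). -/
theorem mixTranslate_dissipatesAtScale_comp_add
    {u : ℝ → EuclideanSpace ℝ (Fin 3) → EuclideanSpace ℝ (Fin 3)} {T : ℝ}
    {x₁ : EuclideanSpace ℝ (Fin 3)} {r δ : ℝ} (c : EuclideanSpace ℝ (Fin 3))
    (h : DissipatesAtScale u T (x₁ + c) r δ) :
    DissipatesAtScale (fun t y => u t (y + c)) T x₁ r δ := by
  intro θ' hs' hd' he' hsupp'
  have key := h (fun t x => θ' t (x + -c))
    (hs'.comp_add_curve (ξ := fun _ => -c) contDiff_const)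
    (mixTranslate_hasUniformRapidDecayOn_comp_add hd' (-c)) ?_ ?_
  · -- translate the two integrals back to the moving frame
    have h1 := integral_add_right_eq_self (μ := (volume : Measure (EuclideanSpace ℝ (Fin 3))))
      (fun x => (θ' (T - r ^ 2 / 2) x) ^ 2) (-c)
    have h2 := integral_add_right_eq_self (μ := (volume : Measure (EuclideanSpace ℝ (Fin 3))))
      (fun x => (θ' (T - r ^ 2) x) ^ 2) (-c)
    rw [h1, h2] at key
    exact key
  · -- the advection–diffusion equation in the original frame
    intro t ht x
    have e := he' t ht (x + -c)
    simp only [neg_add_cancel_right] at e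
    rw [mixTranslate_timeDerivWithin_comp_add, mixTranslate_gradient_comp_add,
      laplacian_comp_add_right]
    exact e
  · -- the datum is supported in the translated ball
    intro x hx
    have h1 : θ' (T - r ^ 2) (x + -c) ≠ 0 := hx
    have h2 : x + -c ∈ Metric.ball x₁ r := hsupp' (Function.mem_support.mpr h1)
    rw [Metric.mem_ball] at h2 ⊢
    rwa [← dist_add_right x (x₁ + c) (-c), add_neg_cancel_right]

/-- **INV1 — translation invariance of `DissipatesAtScale`** (registered sub-goal
`stub_dissipatesAtScale_translate` of the crux `CoherentScaleExclusion`, line `registered`,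
lead c3). The scalar dissipation factor of `u` at `(T, x₀)` equals that of the translated drift
`(t, y) ↦ u t (y + x₀)` at `(T, 0)`: admissible scalars correspond under `θ ↦ θ(t, · + x₀)`
(joint smoothness, uniform rapid decay with shifted polynomial weights, `timeDerivWithin` is
pointwise in `x`, `gradient`/`Δ` commute with translations, supports and whole-space integrals
are translation invariant). Both directions are `mixTranslate_dissipatesAtScale_comp_add`
(shift `x₀`, resp. shift `−x₀` applied to the translated drift). -/
theorem stub_dissipatesAtScale_translate :
    ∀ (u : ℝ → EuclideanSpace ℝ (Fin 3) → EuclideanSpace ℝ (Fin 3)) (T : ℝ) (x₀ : EuclideanSpace ℝ (Fin 3))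
      (r δ : ℝ),
      DissipatesAtScale u T x₀ r δ ↔ DissipatesAtScale (fun t y => u t (y + x₀)) T 0 r δ := by
  intro u T x₀ r δ
  constructor
  · intro h
    exact mixTranslate_dissipatesAtScale_comp_add (x₁ := 0) x₀ (by rwa [zero_add])
  · intro h
    have key := mixTranslate_dissipatesAtScale_comp_add (u := fun t y => u t (y + x₀)) (x₁ := x₀)
      (-x₀) (by rwa [add_neg_cancel])
    simp only [neg_add_cancel_right] at key
    exact key

end Summit.NavierStokesRegularity.NavierStokesRegularity.Theorems
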